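import Literature.NumberTheory.Automorphic.EichlerSubidealCount
import Literature.NumberTheory.Automorphic.BrandtModuleEichlerResidue
import HarnessLib

/-!
# Stub `stub_pollackWestonLemma21` of line «defmu», crux 2 `KobayashiLowerHalfSemistable` (stmt-BirchSwinnertonDyer-19000) —
# part 1/3: primitive cube roots of unity in quaternion orders; Thue's lemma for `ℤ[ζ₃]`; residue maps of Eichler orders

Route-independent `Theorems` file (cell `b2b-bsdres`, seat `b2b-bsdres-x10b` = class owner X6, gen 41), helper toward the
registered stub `stub_pollackWestonLemma21` of skeleton «defmu» v6 (= the Literature named fact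
`pollackWeston2011_lemma21_exists_not_dvd_weight_mul`, Pollack–Weston 2011 §2.1 Lemma 2.1: "there is some `m ∈ ℳ` with
`⟨m, g_f⟩` a unit", i.e. `∃ c, p ∤ w_c φ_c`), which part 3/3 (`…DefmuPollackWestonLemma21.lean`) PROVES.
HONEST FRAMING: prove what is provable now; shrink each hard class to its core with data; no claim beyond stated
classes. Nothing about any curve is asserted and NO summit statement is proved here; BSD is not proved by any of this.

The content of Lemma 2.1 is at `p = 3` (for `p ≥ 5` the weights `w_c ∣ 12` are prime to `p`), where the classes `c` with
`3 ∣ w_c` are those whose left order `O_L(I_c)` contains a unit `u` of order `3`, a primitive cube root of unity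
`u² + u + 1 = 0`. This part collects the arithmetic of such a `u` inside a `ℤ`-order `O` of a quaternion algebra over `ℚ`:

* `isMatrixResidueMap_map_ringEquiv` (private), `exists_isMatrixResidueMap_of_isEichlerOrder` — an Eichler order `O` of
  level `N`, `p ∤ N`, in an algebra split at `p`, has a matrix residue map `O → M₂(ℤ/p)` (surjective, kernel `p O`): from
  the maximal order `O₁ ⊇ O` of index `N` (`exists_modPow_reduction`, Vignéras II §2 Thm. 2.3 (1)) and `p O₁ ∩ O = p O`,
  `O ↠ O₁ / p O₁` (`BrandtModuleEichlerResidue.lean`).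
* `EisensteinNorm.exists_sq_sub_mul_add_sq_eq_prime` — **Thue's lemma for the norm form of `ℤ[ζ₃]`**: a prime
  `ℓ ∣ a² + a + 1` is `m² - m n + n²` with `ℓ ∣ m + n a` (pigeonhole on `x + a y mod ℓ`, `0 ≤ x, y ≤ √ℓ`; the value `2ℓ`
  is excluded by parity).
* `trdZ_nrdZ_of_cubeRoot` — `trd u = -1`, `nrd u = 1` for `u ∈ O` with `u² + u + 1 = 0` (else `u` would be a rational root
  of `x² + x + 1`).
* `residue_cubeRoot_ne_smul_one` — **the residue `ψ u ∈ M₂(𝔽_ℓ)` of such a `u` is never a scalar**: `ψ u = c` would give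
  `u - c̃ ∈ ℓ O`, hence `ℓ ∣ 2c̃ + 1` (trace) and `ℓ² ∣ c̃² + c̃ + 1` (norm), so `ℓ² ∣ 3`.

## References

* M.-F. Vignéras, *Arithmétique des algèbres de quaternions*, LNM 800 (1980), Ch. I §1 Lemme 1.1, §4 Lemme 4.1, Ch. II §2
  Thm. 2.3 (1) [VignerasLNM800].
* R. Pollack, T. Weston, *On anticyclotomic μ-invariants of modular forms*, Compos. Math. 147 (2011), §2.1 Lemma 2.1
  [PollackWeston2011].
-/

noncomputable section

open scoped Pointwise Matrix TensorProduct

open Literature.NumberTheory.Automorphic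

universe u

-- D-0017: single-problem summit, the namespace repeats the problem name by design.
set_option linter.dupNamespace false

namespace Summit.BirchSwinnertonDyer.BirchSwinnertonDyer.Theorems.PollackWestonLemma21

variable {B : Type u} [Ring B] [Algebra ℚ B] [IsQuaternionAlgebra ℚ B]

/-! ### A matrix residue map modulo `p` for an Eichler order of level prime to `p` -/

omit [Algebra ℚ B] [IsQuaternionAlgebra ℚ B] in
/-- Transport of a matrix residue map along a ring isomorphism of the coefficient field. [folklore] -/
private theorem isMatrixResidueMap_map_ringEquiv {O : Submodule ℤ B} {p : ℕ} {F F' : Type*} [Field F] [Field F']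
    {ψ : B → Matrix (Fin 2) (Fin 2) F} (h : IsMatrixResidueMap O p ψ) (e : F ≃+* F') :
    IsMatrixResidueMap O p (fun x => e.mapMatrix (ψ x)) where
  map_add x hx y hy := by rw [h.map_add x hx y hy, RingEquiv.map_add]
  map_mul x hx y hy := by rw [h.map_mul x hx y hy, RingEquiv.map_mul]
  map_one := by rw [h.map_one, RingEquiv.map_one]
  surj m := by
    obtain ⟨x, hx, hxm⟩ := h.surj (e.symm.mapMatrix m)
    refine ⟨x, hx, ?_⟩
    rw [hxm]
    ext i j
    simp
  ker x hx := by
    rw [← h.ker x hx]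
    constructor
    · intro h0
      have h1 : e.symm.mapMatrix (e.mapMatrix (ψ x)) = 0 := by rw [h0, RingEquiv.map_zero]
      have h2 : e.symm.mapMatrix (e.mapMatrix (ψ x)) = ψ x := by
        ext i j; simp
      rw [h2] at h1; exact h1
    · intro h0; rw [h0, RingEquiv.map_zero]

/-- **An Eichler order of level `N` prime to `p`, in a quaternion algebra split at `p`, has a matrix
residue map modulo `p`**: `O / p O ≅ O₁ / p O₁ ≅ M₂(𝔽_p)` for the maximal order `O₁ ⊇ O` of index
`N` (`p O₁ ∩ O = p O`, `O → O₁ / p O₁` onto; Vignéras II §2 Thm. 2.3 (1) for `O₁`).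
[cite: VignerasLNM800, Ch. II §2 Thm. 2.3 (1)] -/
theorem exists_isMatrixResidueMap_of_isEichlerOrder {O : Submodule ℤ B} {N : ℕ}
    (hO : Literature.NumberTheory.Automorphic.IsEichlerOrder O N)
    {p : ℕ} [Fact p.Prime] (hpN : ¬ p ∣ N)
    (hsplit : Nonempty (ℚ_[p] ⊗[ℚ] B ≃ₐ[ℚ_[p]] Matrix (Fin 2) (Fin 2) ℚ_[p])) :
    ∃ ψ : B → Matrix (Fin 2) (Fin 2) (ZMod p), IsMatrixResidueMap O p ψ := by
  have hp : p.Prime := Fact.out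
  obtain ⟨O₁, O₂, h₁, -, hO12, hidx⟩ := hO
  have hle : O ≤ O₁ := hO12 ▸ inf_le_left
  have hcop : p.Coprime N := (Nat.Prime.coprime_iff_not_dvd hp).mpr hpN
  obtain ⟨ψ₀, hadd, hmul, hone, hsurj, hker⟩ := exists_modPow_reduction h₁ hsplit 1
  haveI : Fact (Nat.Prime (p ^ 1)) := ⟨by rw [pow_one]; exact hp⟩
  have h₀ : IsMatrixResidueMap O₁ p ψ₀ :=
    ⟨hadd, hmul, hone, hsurj, fun x hx => by rw [hker x hx, pow_one]⟩
  let e : ZMod (p ^ 1) ≃+* ZMod p := ZMod.ringEquivCongr (pow_one p)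
  have h₁' := isMatrixResidueMap_map_ringEquiv h₀ e
  set ψ : B → Matrix (Fin 2) (Fin 2) (ZMod p) := fun x => e.mapMatrix (ψ₀ x)
  refine ⟨ψ, ⟨fun x hx y hy => h₁'.map_add x (hle hx) y (hle hy),
    fun x hx y hy => h₁'.map_mul x (hle hx) y (hle hy), h₁'.map_one, fun m => ?_, fun x hx => ?_⟩⟩
  · obtain ⟨x₁, hx₁, hx₁m⟩ := h₁'.surj m
    obtain ⟨x, hx, hxx⟩ := exists_mem_sub_mem_smul hidx hcop hx₁
    refine ⟨x, hx, ?_⟩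
    obtain ⟨y, hy, hyx⟩ := (Submodule.mem_smul_pointwise_iff_exists _ _ O₁).mp hxx
    have hψ0 : ψ (x - x₁) = 0 := (h₁'.ker _ (O₁.sub_mem (hle hx) hx₁)).mpr ⟨y, hy, hyx.symm⟩
    have : x = x₁ + (x - x₁) := by abel
    rw [this, h₁'.map_add x₁ hx₁ _ (O₁.sub_mem (hle hx) hx₁), hψ0, add_zero, hx₁m]
  · rw [h₁'.ker x (hle hx)]
    constructor
    · rintro ⟨y, hy, hxy⟩
      have hx' : x ∈ (p : ℤ) • O₁ :=
        (Submodule.mem_smul_pointwise_iff_exists _ _ O₁).mpr ⟨y, hy, hxy.symm⟩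
      obtain ⟨z, hz, hzx⟩ := (Submodule.mem_smul_pointwise_iff_exists _ _ O).mp
        (mem_smul_of_mem_smul_of_coprime hidx hcop hx hx')
      exact ⟨z, hz, hzx.symm⟩
    · rintro ⟨y, hy, hxy⟩
      exact ⟨y, hle hy, hxy⟩

/-! ### Thue's lemma for the norm form `m² - m n + n²` of `ℤ[ζ₃]` -/

namespace EisensteinNorm

/-- In `ZMod 2`, `m² - m n + n² = 0` forces `m = n = 0`. [folklore] -/
private theorem zmod_two_form_eq_zero {m n : ZMod 2} (h : m ^ 2 - m * n + n ^ 2 = 0) : m = 0 ∧ n = 0 := by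
  revert h; revert m n; decide

/-- `a² + a + 1 = a(a + 1) + 1` is odd. [folklore] -/
private theorem two_not_dvd_sq_add_self_add_one (a : ℤ) : ¬ (2 : ℤ) ∣ a ^ 2 + a + 1 := by
  intro h
  have h1 : (2 : ℤ) ∣ a * (a + 1) := (Int.even_mul_succ_self a).two_dvd
  have h2 : (2 : ℤ) ∣ a ^ 2 + a + 1 - a * (a + 1) := dvd_sub h h1
  have h3 : a ^ 2 + a + 1 - a * (a + 1) = 1 := by ring
  rw [h3] at h2
  exact absurd (Int.eq_one_of_dvd_one (by norm_num) h2) (by norm_num)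

/-- The norm form `m² - m n + n²` does not take the value `2ℓ` at a prime `ℓ ∣ a² + a + 1`
(parity: `m, n` would both be even, so `4 ∣ 2ℓ`, `ℓ = 2`, but `a² + a + 1` is odd). [folklore] -/
private theorem form_ne_two_mul_prime {ℓ : ℕ} (hℓ : ℓ.Prime) {a m n : ℤ} (ha : (ℓ : ℤ) ∣ a ^ 2 + a + 1)
    (h : m ^ 2 - m * n + n ^ 2 = 2 * ℓ) : False := by
  have h2 : ((m ^ 2 - m * n + n ^ 2 : ℤ) : ZMod 2) = 0 := by
    rw [ZMod.intCast_zmod_eq_zero_iff_dvd]; exact ⟨ℓ, by rw [h]; ring⟩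
  push_cast at h2
  obtain ⟨hm0, hn0⟩ := zmod_two_form_eq_zero h2
  rw [ZMod.intCast_zmod_eq_zero_iff_dvd] at hm0 hn0
  obtain ⟨m', hm'⟩ := hm0
  obtain ⟨n', hn'⟩ := hn0
  have h4 : (ℓ : ℤ) = 2 * (m' ^ 2 - m' * n' + n' ^ 2) := by
    have : (2 : ℤ) * ℓ = 2 * (2 * (m' ^ 2 - m' * n' + n' ^ 2)) := by rw [← h, hm', hn']; ring
    linarith
  have h2ℓ' : (2 : ℤ) ∣ (ℓ : ℤ) := ⟨_, h4⟩
  have h2ℓ : (2 : ℕ) ∣ ℓ := by exact_mod_cast h2ℓ'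
  have hℓ2 : ℓ = 2 := (((Nat.dvd_prime hℓ).mp h2ℓ).resolve_left (by norm_num)).symm
  rw [hℓ2] at ha
  exact two_not_dvd_sq_add_self_add_one a (by exact_mod_cast ha)

/-- Core of Thue's argument: a small non-zero vector `(m, n)` with `ℓ ∣ m + n a` (so that
`ℓ ∣ m² - m n + n²`) and `m² - m n + n² < 3ℓ` represents `ℓ`. [folklore] -/
private theorem form_eq_prime_of_small {ℓ : ℕ} (hℓ : ℓ.Prime) {a m n : ℤ} (ha : (ℓ : ℤ) ∣ a ^ 2 + a + 1)
    (hmn : m ≠ 0 ∨ n ≠ 0) (hdvd : (ℓ : ℤ) ∣ m + n * a)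
    (hsmall : m ^ 2 - m * n + n ^ 2 < 3 * ℓ) : m ^ 2 - m * n + n ^ 2 = ℓ := by
  have h4N : 4 * (m ^ 2 - m * n + n ^ 2) = (2 * m - n) ^ 2 + 3 * n ^ 2 := by ring
  have hNpos : 0 < m ^ 2 - m * n + n ^ 2 := by
    by_cases hn0 : n = 0
    · have hm0 : m ≠ 0 := hmn.resolve_right (not_not.mpr hn0)
      have := sq_pos_of_ne_zero hm0
      rw [hn0] at h4N ⊢
      nlinarith
    · have := sq_pos_of_ne_zero hn0
      nlinarith [sq_nonneg (2 * m - n)]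
  -- `ℓ ∣ N`
  have hℓN : (ℓ : ℤ) ∣ m ^ 2 - m * n + n ^ 2 := by
    have hid : m ^ 2 - m * n + n ^ 2 = (m + n * a) * (m - (a + 1) * n) + n ^ 2 * (a ^ 2 + a + 1) := by
      ring
    rw [hid]
    exact dvd_add (hdvd.mul_right _) (ha.mul_left _)
  obtain ⟨c, hc⟩ := hℓN
  have hℓpos : (0 : ℤ) < ℓ := by exact_mod_cast hℓ.pos
  rw [hc] at hNpos hsmall
  have hc1 : 0 < c := (mul_pos_iff_of_pos_left hℓpos).mp hNpos
  have hc3 : c < 3 := lt_of_mul_lt_mul_left (by linarith) hℓpos.le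
  have hc2 : c ≠ 2 := fun hc2 => form_ne_two_mul_prime hℓ ha (m := m) (n := n) (by rw [hc, hc2]; ring)
  have hc' : c = 1 := by omega
  rw [hc, hc', mul_one]

/-- **Thue's lemma for `ℤ[ζ₃]`**: if a prime `ℓ` divides `a² + a + 1` then `ℓ = m² - m n + n²` with
`ℓ ∣ m + n a` (the prime `(ℓ, ζ₃ - a)` of `ℤ[ζ₃]` above `ℓ` is principal, generated by `m + n ζ₃`;
Fermat–Euler–Thue): pigeonhole on `(x, y) ↦ x + a y (mod ℓ)` over `0 ≤ x, y ≤ ⌊√ℓ⌋`, then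
`form_eq_prime_of_small`. [folklore] -/
theorem exists_sq_sub_mul_add_sq_eq_prime {ℓ : ℕ} (hℓ : ℓ.Prime) {a : ℤ}
    (ha : (ℓ : ℤ) ∣ a ^ 2 + a + 1) :
    ∃ m n : ℤ, m ^ 2 - m * n + n ^ 2 = ℓ ∧ (ℓ : ℤ) ∣ m + n * a := by
  haveI : Fact ℓ.Prime := ⟨hℓ⟩
  obtain ⟨s, rfl⟩ : ∃ s, s = Nat.sqrt ℓ := ⟨_, rfl⟩
  have hlt : ℓ < (Nat.sqrt ℓ + 1) * (Nat.sqrt ℓ + 1) := Nat.lt_succ_sqrt ℓ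
  have hle : Nat.sqrt ℓ * Nat.sqrt ℓ ≤ ℓ := Nat.sqrt_le ℓ
  -- `ℓ` is not a square
  have hss : Nat.sqrt ℓ * Nat.sqrt ℓ ≠ ℓ := by
    intro h
    have hsd : Nat.sqrt ℓ ∣ ℓ := ⟨Nat.sqrt ℓ, h.symm⟩
    rcases (Nat.dvd_prime hℓ).mp hsd with h1 | h1
    · rw [h1, one_mul] at h; exact hℓ.one_lt.ne' h.symm
    · rw [h1] at h; have := hℓ.one_lt; nlinarith
  have hs2 : ((Nat.sqrt ℓ : ℕ) : ℤ) ^ 2 ≤ (ℓ : ℤ) - 1 := by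
    have h1 : ((Nat.sqrt ℓ * Nat.sqrt ℓ : ℕ) : ℤ) ≤ ((ℓ - 1 : ℕ) : ℤ) := by exact_mod_cast (by omega)
    rw [Nat.cast_sub hℓ.one_lt.le] at h1; push_cast at h1; nlinarith
  -- pigeonhole on `(x, y) ↦ x + a y mod ℓ`, `0 ≤ x, y ≤ s`
  let f : Fin (Nat.sqrt ℓ + 1) × Fin (Nat.sqrt ℓ + 1) → ZMod ℓ :=
    fun xy => ((xy.1 : ℕ) : ℤ) + a * ((xy.2 : ℕ) : ℤ)
  have hcard : Fintype.card (ZMod ℓ) < Fintype.card (Fin (Nat.sqrt ℓ + 1) × Fin (Nat.sqrt ℓ + 1)) := by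
    rw [ZMod.card, Fintype.card_prod, Fintype.card_fin]; exact hlt
  obtain ⟨⟨x, y⟩, ⟨x', y'⟩, hne, heq⟩ := Fintype.exists_ne_map_eq_of_card_lt f hcard
  simp only [f] at heq
  have hx : ((x : ℕ) : ℤ) ≤ Nat.sqrt ℓ := by exact_mod_cast Nat.lt_succ_iff.mp x.2
  have hx' : ((x' : ℕ) : ℤ) ≤ Nat.sqrt ℓ := by exact_mod_cast Nat.lt_succ_iff.mp x'.2
  have hy : ((y : ℕ) : ℤ) ≤ Nat.sqrt ℓ := by exact_mod_cast Nat.lt_succ_iff.mp y.2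
  have hy' : ((y' : ℕ) : ℤ) ≤ Nat.sqrt ℓ := by exact_mod_cast Nat.lt_succ_iff.mp y'.2
  have hx0 : (0 : ℤ) ≤ ((x : ℕ) : ℤ) := Nat.cast_nonneg _
  have hx0' : (0 : ℤ) ≤ ((x' : ℕ) : ℤ) := Nat.cast_nonneg _
  have hy0 : (0 : ℤ) ≤ ((y : ℕ) : ℤ) := Nat.cast_nonneg _
  have hy0' : (0 : ℤ) ≤ ((y' : ℕ) : ℤ) := Nat.cast_nonneg _
  refine ⟨((x : ℕ) : ℤ) - ((x' : ℕ) : ℤ), ((y : ℕ) : ℤ) - ((y' : ℕ) : ℤ),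
    form_eq_prime_of_small hℓ ha ?_ ?_ ?_, ?_⟩
  · -- `(m, n) ≠ (0, 0)`
    by_contra h
    rw [not_or, not_not, not_not] at h
    apply hne
    have h1 : (x : ℕ) = x' := by exact_mod_cast sub_eq_zero.mp h.1
    have h2 : (y : ℕ) = y' := by exact_mod_cast sub_eq_zero.mp h.2
    rw [Prod.mk.injEq]; exact ⟨Fin.ext h1, Fin.ext h2⟩
  · rw [← ZMod.intCast_zmod_eq_zero_iff_dvd]
    push_cast at heq ⊢
    linear_combination heq
  · have hmb : (((x : ℕ) : ℤ) - ((x' : ℕ) : ℤ)) ^ 2 ≤ ((Nat.sqrt ℓ : ℕ) : ℤ) ^ 2 :=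
      sq_le_sq' (by linarith) (by linarith)
    have hnb : (((y : ℕ) : ℤ) - ((y' : ℕ) : ℤ)) ^ 2 ≤ ((Nat.sqrt ℓ : ℕ) : ℤ) ^ 2 :=
      sq_le_sq' (by linarith) (by linarith)
    nlinarith [sq_nonneg ((((x : ℕ) : ℤ) - ((x' : ℕ) : ℤ)) + (((y : ℕ) : ℤ) - ((y' : ℕ) : ℤ)))]
  · rw [← ZMod.intCast_zmod_eq_zero_iff_dvd]
    push_cast at heq ⊢
    linear_combination heq


end EisensteinNorm

/-! ### Primitive cube roots of unity in an order: `trd u = -1`, `nrd u = 1` -/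

/-- A rational number is never a primitive cube root of unity: `q² + q + 1 ≠ 0`. [folklore] -/
private theorem rat_sq_add_self_add_one_ne_zero (q : ℚ) : q ^ 2 + q + 1 ≠ 0 := by
  intro h; nlinarith [sq_nonneg (2 * q + 1)]

/-- **A primitive cube root of unity `u` (`u² + u + 1 = 0`) in a `ℤ`-order of a quaternion algebra
over `ℚ` has reduced trace `-1` and reduced norm `1`**: from `u² = t u - n` (`t, n ∈ ℤ`) we get
`(t + 1) u = (n - 1) · 1`; if `t ≠ -1` then `u` would be the rational scalar `(n-1)/(t+1)`, a root
of `x² + x + 1` in `ℚ`; so `t = -1` and then `n = 1`. [folklore] -/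
theorem trdZ_nrdZ_of_cubeRoot {O : Submodule ℤ B} (hO : IsZOrder O) {u : B} (hu : u ∈ O)
    (hcube : u * u + u + 1 = 0) : trdZ u = -1 ∧ nrdZ u = 1 := by
  haveI : Nontrivial B := Module.nontrivial_of_finrank_pos (R := ℚ)
    (by rw [IsQuaternionAlgebra.finrank_eq_four (K := ℚ) (D := B)]; norm_num)
  have h1 : (1 : B) ≠ 0 := one_ne_zero
  have hkey : (trdZ u + 1 : ℤ) • u = (nrdZ u - 1 : ℤ) • (1 : B) := by
    have h := hO.mul_self_eq_trdZ hu
    have h' : u * u = -u - 1 := by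
      rw [← sub_eq_zero, ← hcube]; noncomm_ring
    have h2 : (trdZ u : ℤ) • u - (nrdZ u : ℤ) • (1 : B) = -u - 1 := h.symm.trans h'
    rw [add_smul, one_smul, sub_smul, one_smul]
    calc (trdZ u : ℤ) • u + u = ((trdZ u : ℤ) • u - (nrdZ u : ℤ) • (1 : B)) + (nrdZ u : ℤ) • 1 + u := by
          abel
      _ = (-u - 1) + (nrdZ u : ℤ) • 1 + u := by rw [h2]
      _ = (nrdZ u : ℤ) • 1 - 1 := by abel
  -- rational form of `hkey`
  have hkeyQ : ((trdZ u + 1 : ℤ) : ℚ) • u = ((nrdZ u - 1 : ℤ) : ℚ) • (1 : B) := by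
    rw [Int.cast_smul_eq_zsmul, Int.cast_smul_eq_zsmul]; exact hkey
  by_cases ht : trdZ u + 1 = 0
  · have ht' : trdZ u = -1 := by linarith
    refine ⟨ht', ?_⟩
    rw [ht, Int.cast_zero, zero_smul] at hkeyQ
    have h3 := (smul_eq_zero.mp hkeyQ.symm).resolve_right h1
    have : (nrdZ u - 1 : ℤ) = 0 := by exact_mod_cast h3
    linarith
  · exfalso
    -- `u` is the rational scalar `q = (n - 1)/(t + 1)`
    set q : ℚ := (nrdZ u - 1 : ℤ) / (trdZ u + 1 : ℤ) with hq
    have htq : ((trdZ u + 1 : ℤ) : ℚ) ≠ 0 := by exact_mod_cast ht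
    have hu' : u = q • (1 : B) := by
      have h2 := hkeyQ
      have h3 : u = ((trdZ u + 1 : ℤ) : ℚ)⁻¹ • (((trdZ u + 1 : ℤ) : ℚ) • u) := by
        rw [smul_smul, inv_mul_cancel₀ htq, one_smul]
      rw [h3, h2, smul_smul, hq, div_eq_inv_mul]
    have h4 : (q ^ 2 + q + 1) • (1 : B) = 0 := by
      have : u * u + u + 1 = (q ^ 2 + q + 1) • (1 : B) := by
        rw [hu', smul_mul_smul_comm, mul_one, add_smul, add_smul, one_smul, sq]
      rw [← this, hcube]
    exact rat_sq_add_self_add_one_ne_zero q ((smul_eq_zero.mp h4).resolve_right h1)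

/-! ### The residue of a cube root of unity is not a scalar -/

/-- **The image of a primitive cube root of unity `u ∈ O` under a matrix residue map modulo a
prime `ℓ` is not a scalar matrix.** If `ψ u = c · 1`, then `u - c̃ = ℓ y` with `y ∈ O` for a lift
`c̃ ∈ ℤ` of `c`; taking reduced traces and norms, `ℓ ∣ 2c̃ + 1` and `ℓ² ∣ c̃² + c̃ + 1`, whence
`ℓ² ∣ 4(c̃² + c̃ + 1) - (2c̃ + 1)² = 3`, absurd. [folklore] -/
theorem residue_cubeRoot_ne_smul_one {O : Submodule ℤ B} (hO : IsZOrder O) {ℓ : ℕ}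
    [Fact ℓ.Prime] {ψ : B → Matrix (Fin 2) (Fin 2) (ZMod ℓ)} (h : IsMatrixResidueMap O ℓ ψ)
    {u : B} (hu : u ∈ O) (hcube : u * u + u + 1 = 0) (c : ZMod ℓ) :
    ψ u ≠ c • (1 : Matrix (Fin 2) (Fin 2) (ZMod ℓ)) := by
  intro hc
  have hℓ : ℓ.Prime := Fact.out
  set c' : ℤ := ((c.val : ℕ) : ℤ) with hc'
  have hcc : ((c' : ℤ) : ZMod ℓ) = c := by rw [hc', Int.cast_natCast, ZMod.natCast_zmod_val]
  have h1O : (1 : B) ∈ O := hO.one_mem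
  have hx : u - c' • (1 : B) ∈ O := O.sub_mem hu (O.smul_mem _ h1O)
  have hψ : ψ (u - c' • (1 : B)) = 0 := by
    rw [h.map_sub hu (O.smul_mem _ h1O), h.map_zsmul h1O, h.map_one, hc, ← Int.cast_smul_eq_zsmul (ZMod ℓ),
      hcc, sub_self]
  obtain ⟨y, hy, hyeq⟩ := (h.ker _ hx).mp hψ
  obtain ⟨ht, hn⟩ := trdZ_nrdZ_of_cubeRoot hO hu hcube
  have hneg : u - c' • (1 : B) = u + (-c') • (1 : B) := by rw [neg_smul, sub_eq_add_neg]
  have hsm : (-c') • (1 : B) ∈ O := O.smul_mem _ h1O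
  -- reduced trace: `-1 - 2 c' = ℓ · trd y`
  have htr : trdZ (u - c' • (1 : B)) = -1 - 2 * c' := by
    rw [hneg, hO.trdZ_add hu hsm, hO.trdZ_zsmul _ h1O, IsZOrder.trdZ_one, ht]; ring
  have htr' : trdZ (u - c' • (1 : B)) = ℓ * trdZ y := by rw [hyeq, hO.trdZ_zsmul _ hy]
  -- reduced norm: `c'² + c' + 1 = ℓ² · nrd y`
  have hmul1 : u * ((-c') • (1 : B)) = (-c') • u := by rw [mul_smul_comm, mul_one]
  have hnr : nrdZ (u - c' • (1 : B)) = c' ^ 2 + c' + 1 := by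
    rw [hneg, hO.nrdZ_add hu hsm, hO.nrdZ_zsmul _ h1O, IsZOrder.nrdZ_one, hn, IsZOrder.polZ,
      hO.trdZ_zsmul _ h1O, IsZOrder.trdZ_one, ht, hmul1, hO.trdZ_zsmul _ hu, ht]
    ring
  have hnr' : nrdZ (u - c' • (1 : B)) = (ℓ : ℤ) ^ 2 * nrdZ y := by rw [hyeq, hO.nrdZ_zsmul _ hy]
  have hd1 : (ℓ : ℤ) ∣ 2 * c' + 1 := ⟨-trdZ y, by linarith⟩
  have hd2 : (ℓ : ℤ) ^ 2 ∣ c' ^ 2 + c' + 1 := ⟨nrdZ y, by linarith⟩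
  have hd3 : (ℓ : ℤ) ^ 2 ∣ (2 * c' + 1) ^ 2 := pow_dvd_pow_of_dvd hd1 2
  have hd4 : (ℓ : ℤ) ^ 2 ∣ 3 := by
    have := dvd_sub (hd2.mul_left 4) hd3
    have hid : 4 * (c' ^ 2 + c' + 1) - (2 * c' + 1) ^ 2 = 3 := by ring
    rwa [hid] at this
  have hle : (ℓ : ℤ) ^ 2 ≤ 3 := Int.le_of_dvd (by norm_num) hd4
  have h2 : (2 : ℤ) ≤ ℓ := by exact_mod_cast hℓ.two_le
  nlinarith

end Summit.BirchSwinnertonDyer.BirchSwinnertonDyer.Theorems.PollackWestonLemma21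

end
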